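import Mathlib
import Literature.AlgebraicGeometry.HyperbolicPolynomials.HyperbolicityCone
import Summits.ValiantsHypothesis.ValiantsHypothesis.Theorems.PermanentalConesPermanentalConeHardHyperplaneVanishing
import Summits.ValiantsHypothesis.ValiantsHypothesis.Theorems.PermanentalConesPermanentalConeHardContactVanishing
import Summits.ValiantsHypothesis.ValiantsHypothesis.Theorems.PermanentalConesPermanentalConeHardKnapsackSpan

/-!
# `PermanentalConeHard` (stmt-ValiantsHypothesis-8654), line `birth` — the facet-contact obstruction

Route `PermanentalCones` of `ValiantsHypothesis`, crux `PermanentalConeHard` (H+), core stub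
`stub_permanentalGradientPsdRank` (super-quasi-polynomial psd-rank of permanental gradient slack
matrices).  The only engine in print for super-quasi-polynomial psd-rank lower bounds is the
Lee–Raghavendra–Steurer theorem for the KNAPSACK PATTERN MATRICES `M_n^f(S, a) = f(a_S)`
(`f(x) = ((Σxᵢ − m/2)² − 1/4)`, `m = 2k+1`, `S ∈ ([n] choose m)`, `a ∈ {0,1}ⁿ`; arXiv:1411.6317
Thm 3.8/5.4), the slack matrix of the pair (correlation-polytope cone `C_in = cone{v_a}` in moment
coordinates `v_a = (1, aᵢ, aᵢaⱼ)`, knapsack relaxation `C_out = {f_S ≥ 0 ∀ S}`).  To feed it into the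
core stub one would need a hyperbolicity cone `Λ₊(q)` (a linear pull-back of a permanental cone)
SANDWICHED as `C_in ⊆ Λ₊(q) ⊆ C_out`.  This file proves that such a sandwich forces

  `C(n, 2k+1) ≤ deg q`          (`stub_noExactKnapsackSandwich`),

so no hyperbolicity cone of polynomial degree realises the LRS pattern matrices with their zero
pattern as tight contacts (lead c2, `Cruxes/PermanentalConeHard/CORE-analysis-c2.md` §3).  Proof:
for each `S` the contact points `{v_a : |a ∩ S| ∈ {k, k+1}}` span the hyperplane `ker f_S`
(`stub_knapsackContactSpan`, via finite-dimensional duality), so `q` vanishes on a relatively open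
piece of `ker f_S` (`stub_hyperplaneContactVanishing`), and `C(n,m)` pairwise non-proportional
linear forms dividing `q` force the degree (`stub_linearFactorsOfHyperplaneVanishing`).

Coordinates: `Option (Fin n ⊕ {p : Fin n × Fin n // p.1 < p.2})` — `none` is the homogenising
coordinate, `inl i` the linear and `inr (i,j)` (`i < j`) the quadratic moments; the moment vector of
`A ⊆ Fin n` and the knapsack covector of `S` are written inline (no definitions).
-/

set_option linter.dupNamespace false

namespace Summit.ValiantsHypothesis.ValiantsHypothesis.Theorems.PermanentalConesPermanentalConeHard

open Finset MvPolynomial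
open scoped BigOperators
open Literature.AlgebraicGeometry.HyperbolicPolynomials

namespace KnapsackSandwich

variable {n : ℕ}

/-- Pair count: `Σ_{i,j ∈ T} [i < j] = |T|(|T|−1)/2`. [folklore] -/
theorem sum_sum_ite_lt (T : Finset (Fin n)) :
    (∑ i ∈ T, ∑ j ∈ T, (if i < j then (1 : ℝ) else 0)) =
      (T.card : ℝ) * ((T.card : ℝ) - 1) / 2 := by
  induction T using Finset.induction_on with
  | empty => simp
  | insert a T ha ih =>
    have hrow : ∀ i ∈ T, (∑ j ∈ insert a T, (if i < j then (1 : ℝ) else 0)) =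
        (if i < a then (1 : ℝ) else 0) + ∑ j ∈ T, (if i < j then (1 : ℝ) else 0) :=
      fun i _ => Finset.sum_insert ha
    rw [Finset.sum_insert ha, Finset.sum_insert ha, if_neg (lt_irrefl a), zero_add,
      Finset.sum_congr rfl hrow, Finset.sum_add_distrib, ih, Finset.card_insert_of_notMem ha]
    have hcount : (∑ j ∈ T, (if a < j then (1 : ℝ) else 0)) +
        (∑ i ∈ T, (if i < a then (1 : ℝ) else 0)) = T.card := by
      rw [← Finset.sum_add_distrib, Finset.card_eq_sum_ones, Nat.cast_sum]
      refine Finset.sum_congr rfl fun i hi => ?_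
      have hne : i ≠ a := fun h => ha (h ▸ hi)
      rcases lt_or_gt_of_ne hne with h | h
      · rw [if_neg (not_lt_of_gt h), if_pos h]; simp
      · rw [if_pos h, if_neg (not_lt_of_gt h)]; simp
    push_cast
    linarith

/-- Expansion of a covector against the moment vector of `A`:
`⟨c, v_A⟩ = c_∅ + Σ_{i∈A} c_i + Σ_{i<j∈A} c_{ij}`. [folklore] -/
theorem dotProduct_momentVec (c : Option (Fin n ⊕ {p : Fin n × Fin n // p.1 < p.2}) → ℝ)
    (A : Finset (Fin n)) :
    dotProduct c (fun o : Option (Fin n ⊕ {p : Fin n × Fin n // p.1 < p.2}) =>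
        Option.elim o (1 : ℝ) (Sum.elim (fun i => if i ∈ A then (1 : ℝ) else 0)
          (fun p => if p.1.1 ∈ A ∧ p.1.2 ∈ A then (1 : ℝ) else 0))) =
      c none + (∑ i ∈ A, c (some (Sum.inl i))) +
        ∑ i ∈ A, ∑ j ∈ A, (if h : i < j then c (some (Sum.inr ⟨(i, j), h⟩)) else 0) := by
  classical
  have hlin : (∑ i : Fin n, c (some (Sum.inl i)) * (if i ∈ A then (1 : ℝ) else 0)) =
      ∑ i ∈ A, c (some (Sum.inl i)) := by
    simp only [mul_ite, mul_one, mul_zero]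
    rw [Finset.sum_ite_mem, Finset.univ_inter]
  have hquad : (∑ p : {p : Fin n × Fin n // p.1 < p.2},
      c (some (Sum.inr p)) * (if (p.1.1 ∈ A ∧ p.1.2 ∈ A) then (1 : ℝ) else 0)) =
      ∑ i ∈ A, ∑ j ∈ A, (if h : i < j then c (some (Sum.inr ⟨(i, j), h⟩)) else 0) := by
    -- an ambient function on all ordered pairs
    set f : Fin n × Fin n → ℝ := fun q =>
      if h : q.1 < q.2 then (if (q.1 ∈ A ∧ q.2 ∈ A) then c (some (Sum.inr ⟨q, h⟩)) else 0) else 0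
      with hf
    have h1 : (∑ p : {p : Fin n × Fin n // p.1 < p.2},
        c (some (Sum.inr p)) * (if (p.1.1 ∈ A ∧ p.1.2 ∈ A) then (1 : ℝ) else 0)) =
        ∑ p : {p : Fin n × Fin n // p.1 < p.2}, f p.1 := by
      refine Finset.sum_congr rfl fun p _ => ?_
      rw [hf]
      dsimp only
      rw [dif_pos p.2]
      split_ifs <;> simp
    have h2 : (∑ p : {p : Fin n × Fin n // p.1 < p.2}, f p.1) =
        ∑ q ∈ (Finset.univ.filter fun q : Fin n × Fin n => q.1 < q.2), f q :=
      (Finset.sum_subtype _ (fun q => by simp) f).symm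
    have h3 : (∑ q ∈ (Finset.univ.filter fun q : Fin n × Fin n => q.1 < q.2), f q) =
        ∑ q : Fin n × Fin n, f q := by
      rw [Finset.sum_filter]
      refine Finset.sum_congr rfl fun q _ => ?_
      split_ifs with h
      · rfl
      · rw [hf]
        dsimp only
        rw [dif_neg h]
    have h4 : (∑ q : Fin n × Fin n, f q) = ∑ i : Fin n, ∑ j : Fin n, f (i, j) :=
      Fintype.sum_prod_type _
    have h5 : ∀ i : Fin n, (∑ j : Fin n, f (i, j)) =
        if i ∈ A then ∑ j ∈ A, (if h : i < j then c (some (Sum.inr ⟨(i, j), h⟩)) else 0)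
          else 0 := by
      intro i
      by_cases hi : i ∈ A
      · rw [if_pos hi]
        have hre : (∑ j ∈ A, (if h : i < j then c (some (Sum.inr ⟨(i, j), h⟩)) else 0)) =
            ∑ j : Fin n, (if j ∈ A then (if h : i < j then c (some (Sum.inr ⟨(i, j), h⟩)) else 0)
              else 0) := by
          rw [Finset.sum_ite_mem, Finset.univ_inter]
        rw [hre]
        refine Finset.sum_congr rfl fun j _ => ?_
        rw [hf]
        dsimp only
        by_cases hj : j ∈ A
        · simp only [hi, hj, and_self, if_true]
        · simp only [hj, and_false, if_false, dite_eq_ite, ite_self]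
      · rw [if_neg hi]
        refine Finset.sum_eq_zero fun j _ => ?_
        rw [hf]
        dsimp only
        simp only [hi, false_and, if_false, dite_eq_ite, ite_self]
    rw [h1, h2, h3, h4, Finset.sum_congr rfl (fun i _ => h5 i), Finset.sum_ite_mem,
      Finset.univ_inter]
  simp only [dotProduct, Fintype.sum_option, Option.elim_none, Option.elim_some, mul_one,
    Fintype.sum_sum_type, Sum.elim_inl, Sum.elim_inr]
  rw [hlin, hquad, add_assoc]

/-- The value of the knapsack covector `f_S` on the moment vector of `A` is
`(s − k)(s − k − 1)` with `s = |A ∩ S|` (Grigoriev's knapsack quadratic). [folklore] -/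
theorem knapsack_dotProduct_momentVec (k : ℕ) (S A : Finset (Fin n)) :
    dotProduct (fun o : Option (Fin n ⊕ {p : Fin n × Fin n // p.1 < p.2}) =>
        Option.elim o ((k : ℝ) * ((k : ℝ) + 1)) (Sum.elim (fun i => if i ∈ S then -(2 * (k : ℝ)) else 0)
          (fun p => if p.1.1 ∈ S ∧ p.1.2 ∈ S then (2 : ℝ) else 0)))
      (fun o : Option (Fin n ⊕ {p : Fin n × Fin n // p.1 < p.2}) =>
        Option.elim o (1 : ℝ) (Sum.elim (fun i => if i ∈ A then (1 : ℝ) else 0)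
          (fun p => if p.1.1 ∈ A ∧ p.1.2 ∈ A then (1 : ℝ) else 0))) =
      (((A ∩ S).card : ℝ) - k) * (((A ∩ S).card : ℝ) - k - 1) := by
  classical
  rw [dotProduct_momentVec]
  simp only [Option.elim_none, Option.elim_some, Sum.elim_inl, Sum.elim_inr]
  have h1 : (∑ i ∈ A, (if i ∈ S then -(2 * (k : ℝ)) else 0)) = -(2 * (k : ℝ)) * (A ∩ S).card := by
    rw [Finset.sum_ite_mem, Finset.sum_const, nsmul_eq_mul, mul_comm]
  have h2 : (∑ i ∈ A, ∑ j ∈ A, (if h : i < j then (if (i ∈ S ∧ j ∈ S) then (2 : ℝ) else 0) else 0)) =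
      ((A ∩ S).card : ℝ) * (((A ∩ S).card : ℝ) - 1) := by
    have hswap : ∀ i j : Fin n, (if h : i < j then (if (i ∈ S ∧ j ∈ S) then (2 : ℝ) else 0) else 0) =
        if i ∈ S then (if j ∈ S then (if i < j then (2 : ℝ) else 0) else 0) else 0 := by
      intro i j
      split_ifs <;> first | rfl | (exfalso; tauto)
    simp_rw [hswap]
    have hpull : ∀ i : Fin n, (∑ j ∈ A, (if i ∈ S then (if j ∈ S then (if i < j then (2 : ℝ) else 0)
        else 0) else 0)) = if i ∈ S then ∑ j ∈ A ∩ S, (if i < j then (2 : ℝ) else 0) else 0 := by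
      intro i
      split_ifs with hi
      · rw [Finset.sum_ite_mem]
      · simp
    rw [Finset.sum_congr rfl (fun i _ => hpull i), Finset.sum_ite_mem]
    have h22 : (∑ i ∈ A ∩ S, ∑ j ∈ A ∩ S, (if i < j then (2 : ℝ) else 0)) =
        2 * ∑ i ∈ A ∩ S, ∑ j ∈ A ∩ S, (if i < j then (1 : ℝ) else 0) := by
      rw [Finset.mul_sum]
      refine Finset.sum_congr rfl fun i _ => ?_
      rw [Finset.mul_sum]
      refine Finset.sum_congr rfl fun j _ => ?_
      split_ifs <;> simp
    rw [h22, sum_sum_ite_lt]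
    ring
  rw [h1, h2]
  ring

end KnapsackSandwich

open KnapsackSandwich in
/-- Registered form (`stub_noExactKnapsackSandwich`, no-go infrastructure stub of the core
`stub_permanentalGradientPsdRank`): **the facet-contact obstruction.**  Let `m = 2k+1 ≥ 3`.  If a
homogeneous polynomial `q`, hyperbolic w.r.t. `e`, on the moment space
`ℝ^{Option (Fin n ⊕ {i<j})}` has a hyperbolicity cone containing every moment vector
`v_A = (1, [i∈A], [i∈A][j∈A])` (`A ⊆ Fin n`) on which every knapsack covector
`f_S = (k(k+1), −2k[i∈S], 2[i∈S][j∈S])` (`|S| = m`) is nonnegative — i.e. `Λ₊(q,e)` is sandwiched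
between the correlation-polytope cone and its level-`(k,k+1)` knapsack relaxation, the configuration
of the Lee–Raghavendra–Steurer pattern matrices — then `C(n,m) ≤ deg q`.  Hence no hyperbolicity
cone of degree `< C(n,m)` (in particular no linear pull-back of a permanental cone `Λ₊(Q_N)` with
`N < C(n,m)`) realises the LRS knapsack pattern matrix `M_n^f` with its zeros as tight contacts.
[folklore: the contact faces are facets and force linear factors; assembled from
`stub_knapsackContactSpan`, `stub_hyperplaneContactVanishing`,
`stub_linearFactorsOfHyperplaneVanishing`] -/
theorem stub_noExactKnapsackSandwich :
    ∀ (n k : ℕ), 1 ≤ k → ∀ (d : ℕ)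
      (q : MvPolynomial (Option (Fin n ⊕ {p : Fin n × Fin n // p.1 < p.2})) ℝ)
      (e : Option (Fin n ⊕ {p : Fin n × Fin n // p.1 < p.2}) → ℝ),
      q.IsHomogeneous d → IsHyperbolic q e →
      (∀ A : Finset (Fin n), (fun o : Option (Fin n ⊕ {p : Fin n × Fin n // p.1 < p.2}) =>
        Option.elim o (1 : ℝ) (Sum.elim (fun i => if i ∈ A then (1 : ℝ) else 0)
          (fun p => if p.1.1 ∈ A ∧ p.1.2 ∈ A then (1 : ℝ) else 0))) ∈ hyperbolicityCone q e) →
      (∀ S : Finset (Fin n), S.card = 2 * k + 1 → ∀ x ∈ hyperbolicityCone q e,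
        0 ≤ dotProduct (fun o : Option (Fin n ⊕ {p : Fin n × Fin n // p.1 < p.2}) =>
          Option.elim o ((k : ℝ) * ((k : ℝ) + 1))
            (Sum.elim (fun i => if i ∈ S then -(2 * (k : ℝ)) else 0)
              (fun p => if p.1.1 ∈ S ∧ p.1.2 ∈ S then (2 : ℝ) else 0))) x) →
      Nat.choose n (2 * k + 1) ≤ d := by
  intro n k hk d q e hhom hhyp hvA hfS
  classical
  -- the moment vectors and knapsack covectors
  set v : Finset (Fin n) → Option (Fin n ⊕ {p : Fin n × Fin n // p.1 < p.2}) → ℝ :=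
    fun A o => Option.elim o (1 : ℝ) (Sum.elim (fun i => if i ∈ A then (1 : ℝ) else 0)
      (fun p => if p.1.1 ∈ A ∧ p.1.2 ∈ A then (1 : ℝ) else 0)) with hv
  set w : Finset (Fin n) → Option (Fin n ⊕ {p : Fin n × Fin n // p.1 < p.2}) → ℝ :=
    fun S o => Option.elim o ((k : ℝ) * ((k : ℝ) + 1))
      (Sum.elim (fun i => if i ∈ S then -(2 * (k : ℝ)) else 0)
        (fun p => if p.1.1 ∈ S ∧ p.1.2 ∈ S then (2 : ℝ) else 0)) with hw
  have hkpos : (0 : ℝ) < k := by exact_mod_cast hk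
  have hq0 : q ≠ 0 := hhyp.ne_zero
  -- (1) the covectors are nonzero
  have hw0 : ∀ S, w S ≠ 0 := by
    intro S h
    have := congrFun h none
    simp only [hw, Option.elim_none, Pi.zero_apply] at this
    nlinarith
  -- (2) values on moment vectors
  have hval : ∀ S A, dotProduct (w S) (v A) =
      (((A ∩ S).card : ℝ) - k) * (((A ∩ S).card : ℝ) - k - 1) :=
    fun S A => knapsack_dotProduct_momentVec k S A
  -- (3) for each m-subset S: q vanishes on a relatively open piece of ker f_S
  have hopen : ∀ S : Finset (Fin n), S.card = 2 * k + 1 →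
      ∃ U : Set (Option (Fin n ⊕ {p : Fin n × Fin n // p.1 < p.2}) → ℝ), IsOpen U ∧
        (∃ x ∈ U, dotProduct (w S) x = 0) ∧
        ∀ x ∈ U, dotProduct (w S) x = 0 → MvPolynomial.eval x q = 0 := by
    intro S hS
    -- the contact family
    set Z : Finset (Finset (Fin n)) :=
      Finset.univ.filter (fun A => (A ∩ S).card = k ∨ (A ∩ S).card = k + 1) with hZ
    set p : Fin Z.card → Option (Fin n ⊕ {p : Fin n × Fin n // p.1 < p.2}) → ℝ :=
      fun l => v (Z.equivFin.symm l).1 with hp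
    have hpmem : ∀ l, ((Z.equivFin.symm l).1 ∩ S).card = k ∨
        ((Z.equivFin.symm l).1 ∩ S).card = k + 1 := by
      intro l
      have hl : (Z.equivFin.symm l).1 ∈
          Finset.univ.filter (fun A : Finset (Fin n) => (A ∩ S).card = k ∨ (A ∩ S).card = k + 1) :=
        (Z.equivFin.symm l).2
      exact (Finset.mem_filter.1 hl).2
    refine stub_hyperplaneContactVanishing _ d q e hhom hhyp (w S) (hw0 S) (hfS S hS) Z.card p
      (fun l => hvA _) (fun l => ?_) (fun x hx => ?_)
    · -- tight at the contact points
      show dotProduct (w S) (v (Z.equivFin.symm l).1) = 0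
      rw [hval]
      rcases hpmem l with h | h <;> rw [h] <;> push_cast <;> ring
    · -- the contact points span `ker f_S` (finite-dimensional duality + `stub_knapsackContactSpan`)
      rw [← Subspace.dualAnnihilator_dualCoannihilator_eq (W := Submodule.span ℝ (Set.range p)),
        Submodule.mem_dualCoannihilator]
      intro φ hφ
      rw [Submodule.mem_dualAnnihilator] at hφ
      -- coefficients of `φ`
      set c : Option (Fin n ⊕ {p : Fin n × Fin n // p.1 < p.2}) → ℝ :=
        fun o => φ (fun j => if o = j then 1 else 0) with hc
      have hφc : ∀ y, φ y = dotProduct c y := by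
        intro y
        rw [LinearMap.pi_apply_eq_sum_univ φ y]
        simp only [dotProduct, hc, smul_eq_mul]
        exact Finset.sum_congr rfl fun o _ => mul_comm _ _
      set c₂ : Fin n → Fin n → ℝ := fun i j => if h : i < j then c (some (Sum.inr ⟨(i, j), h⟩)) else 0
        with hc₂
      have hzero : ∀ A : Finset (Fin n), ((A ∩ S).card = k ∨ (A ∩ S).card = k + 1) →
          c none + (∑ i ∈ A, c (some (Sum.inl i))) +
            (∑ i ∈ A, ∑ j ∈ A, if i < j then c₂ i j else 0) = 0 := by
        intro A hA
        have hAZ : A ∈ Z := by rw [hZ, Finset.mem_filter]; exact ⟨Finset.mem_univ _, hA⟩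
        have hmem : v A ∈ Submodule.span ℝ (Set.range p) := by
          refine Submodule.subset_span ⟨Z.equivFin ⟨A, hAZ⟩, ?_⟩
          simp [hp]
        have h0 := hφ (v A) hmem
        rw [hφc, hv, dotProduct_momentVec] at h0
        have hsame : ∀ i j : Fin n, (if i < j then c₂ i j else 0) =
            (if h : i < j then c (some (Sum.inr ⟨(i, j), h⟩)) else 0) := by
          intro i j
          rw [hc₂]
          dsimp only
          split_ifs <;> rfl
        simp_rw [hsame]
        exact h0
      obtain ⟨t, ht0, ht1, ht2⟩ := stub_knapsackContactSpan n k S hk hS (c none)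
        (fun i => c (some (Sum.inl i))) c₂ hzero
      have hcw : c = t • w S := by
        funext o
        rcases o with _ | ⟨i⟩ | ⟨⟨⟨i, j⟩, hij⟩⟩
        · simp only [hw, Pi.smul_apply, Option.elim_none, smul_eq_mul]
          rw [ht0]
        · simp only [hw, Pi.smul_apply, Option.elim_some, Sum.elim_inl, smul_eq_mul]
          rw [ht1 i]
          split_ifs <;> ring
        · simp only [hw, Pi.smul_apply, Option.elim_some, Sum.elim_inr, smul_eq_mul]
          have h2 := ht2 i j hij
          rw [hc₂] at h2
          dsimp only at h2
          rw [dif_pos hij] at h2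
          rw [h2]
          split_ifs <;> ring
      rw [hφc, hcw, smul_dotProduct, hx, smul_zero]
  -- (4) the family of `C(n,m)` covectors
  set 𝒮 : Finset (Finset (Fin n)) := (Finset.univ : Finset (Fin n)).powersetCard (2 * k + 1) with h𝒮
  have hK : 𝒮.card = n.choose (2 * k + 1) := by
    rw [h𝒮, Finset.card_powersetCard, Finset.card_univ, Fintype.card_fin]
  set enum : Fin 𝒮.card → Finset (Fin n) := fun i => (𝒮.equivFin.symm i).1 with henum
  have henum_card : ∀ i, (enum i).card = 2 * k + 1 := by
    intro i
    have hi : (𝒮.equivFin.symm i).1 ∈ (Finset.univ : Finset (Fin n)).powersetCard (2 * k + 1) :=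
      (𝒮.equivFin.symm i).2
    exact (Finset.mem_powersetCard.1 hi).2
  have henum_inj : Function.Injective enum :=
    Subtype.val_injective.comp (𝒮.equivFin.symm.injective)
  have hres := stub_linearFactorsOfHyperplaneVanishing _ q 𝒮.card (fun i => w (enum i))
    (fun i => hw0 _) ?_ (fun i => hopen (enum i) (henum_card i))
  · rcases hres with h | h
    · exact absurd h hq0
    · rwa [hK, hhom.totalDegree hq0] at h
  · -- pairwise non-proportional: distinct `S, S'` of the same size differ at some `i ∈ S ∖ S'`
    intro i j hij c hc
    have hne : enum i ≠ enum j := fun h => hij (henum_inj h)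
    have hnot : ¬ enum i ⊆ enum j := fun hsub =>
      hne (Finset.eq_of_subset_of_card_le hsub (by rw [henum_card, henum_card]))
    obtain ⟨a, hai, haj⟩ := Finset.not_subset.1 hnot
    have h1 := congrFun hc (some (Sum.inl a))
    simp only [hw, Option.elim_some, Sum.elim_inl, Pi.smul_apply, smul_eq_mul, if_pos hai,
      if_neg haj, mul_zero] at h1
    linarith

end Summit.ValiantsHypothesis.ValiantsHypothesis.Theorems.PermanentalConesPermanentalConeHard
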